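import Summits.CriticalPhenomena.PercolationContinuityZ3.Theorems.Transplant.SkelPhiKitsA
import Summits.CriticalPhenomena.PercolationContinuityZ3.Theorems.Transplant.SkelPhiSeedKitHab
import Summits.CriticalPhenomena.PercolationContinuityZ3.Theorems.Transplant.SkelKitsHab
import HarnessLib

/-!
# N1 (the `{±1}` node), LEVEL 1, kit adapter file N-K7a: **THE KIT CLAUSE OF THE APRON KIT OVER A HABITAT WINDOW** (`Skelφ.kitClauseAHab`) —
# the (C)/(F) residues read their chains in habitat windows `WinIn ψ Ω ·` (`planarWindowIn`), exploration graph `winGraphIn G Ω`; as in D″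
# (`SkelPhiKitsHab`, p1 gen 9) the plain apron kit of the window `(w₀, R)` (`apronGeomA`, `kitOK_apronA`) is PADDED over `Ω`
# (`habPad`, `kitOKHab_pad`, `shyp_kitHab` — generic, `SkelPhiSeedKitHab`) under `hfull : winLevel ⊆ Ω`, with pinning set
# `pinSetAHab := pinSetA ∪ (inner neighbours of the padded contacts)`

builds on p205010 (kernel theorem, internal audit signed; external expert review pending) — nothing in this file uses p205010; nothing here is a
claim about the open node `SamePDropOfSkeletonNeg`.
Lane `prim-bschramm`, seat `prim-bschramm-p1` (gen 11; design KIT-APRON-N1); helper file (`--supports stmt-CriticalPhenomena-4575 --as helper`).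
* §1 `farSetAHab`, `pinSetAHab`, `pinSetAHab_subset_winLevelIn`, `ctReg_subset_graphBall_w₀`, `not_mem_pinSetAHab_of_mem_ctReg`,
  `seed_notMem_wireSet_of` (the seed/pinning-set disjointness for any set missed by the contact and by the wired regions);
* §2 **`kitClauseAHab`**.
[cite: KozmaNitzan2024, §4 Lemma 10, Steps III–V (pp. 19–22)] [cite: GrimmettPercolation1999, §7.2]
-/

noncomputable section

open MeasureTheory
open scoped Classical

namespace Summit.CriticalPhenomena.PercolationContinuityZ3.Theorems.Transplant

namespace Skelφ

open Literature.Probability.Percolation Literature.Probability.LatticeModels SimpleGraph KNLevels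
open Literature.Probability.Percolation.KozmaNitzan.Cells (oth oth_ne eq_oth_of_ne oth_oth)
open Literature.Barriers.CriticalPhenomena (graphBall graphBall_finite mem_graphBall_self graphBall_mono)
open Skel (winGraph winGraph_adj winGraph_le winGraphIn KitGeom)
open SkelI (kitSeed mem_kitSeed_cases tanOff tanTgt tanTgt_mem kitSeed_congr mem_kitSeed_pad)

variable {V : Type} [DecidableEq V] {G : SimpleGraph V} [G.LocallyFinite] {ψ φ : V → Site 2}

/-! ## §1 The pinning set over the habitat -/

section Defs

variable (G) {Lo Hi : Site 2} (SF : ∀ (i : Fin 2) (σ : ℤˣ), SideForm ψ φ Lo Hi i σ) (P : ApronPrm) (Ω : Finset V) (w₀ : V) (R : ℕ)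
  (lo hi : Site 2) (j : ℕ)

/-- The inner `Ω`-neighbours of the PADDED contacts (the `Ω`-contacts that are not plain contacts of the window `(w₀, R)`). [folklore] -/
def farSetAHab : Finset V :=
  ((outerBoundary (winGraphIn G Ω) (winLevelIn ψ Ω lo hi j)).filter fun x =>
      x ∉ outerBoundary (winGraph G w₀ R) (winLevel G ψ w₀ R lo hi j)).image
    (inNbrIn G ψ Ω (Finset.Icc (lo - (j : Site 2)) (hi + (j : Site 2))))

/-- **The pinning set over the habitat**: `pinSetA` of the plain contacts, plus the inner neighbours of the padded contacts. -/
def pinSetAHab : Finset V :=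
  pinSetA G SF P w₀ R (outerBoundary (winGraph G w₀ R) (winLevel G ψ w₀ R lo hi j)) ∪ farSetAHab G Ω w₀ R lo hi j (ψ := ψ)

end Defs

section Facts

variable {lo hi : Site 2} {j : ℕ} {w₀ : V} {R : ℕ} {Ω : Finset V}
  (SF : ∀ (i : Fin 2) (σ : ℤˣ), SideForm ψ φ (lo - (j : Site 2)) (hi + (j : Site 2)) i σ) {P : ApronPrm}

/-- The pinning set lies in the habitat level (`Ω` full over the plain level). [folklore] -/
theorem pinSetAHab_subset_winLevelIn (hfull : winLevel G ψ w₀ R lo hi j ⊆ Ω) :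
    pinSetAHab G SF P Ω w₀ R lo hi j ⊆ winLevelIn ψ Ω lo hi j := by
  intro v hv
  unfold pinSetAHab at hv
  rcases Finset.mem_union.1 hv with h | h
  · exact winLevel_subset_winLevelIn hfull (pinSetA_subset_winLevel SF P h)
  · unfold farSetAHab at h
    obtain ⟨x, hx, rfl⟩ := Finset.mem_image.1 h
    exact inNbrIn_mem_winLevelIn (Finset.mem_filter.1 hx).1

/-- **The wired region of a near contact lies in `B_G(w₀, R − 2)`** (`N(T₀+2) + N·d + (W + Kmax + R′) + 2 ≤ r₀ ≤ R`). [folklore] -/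
theorem ctReg_subset_graphBall_w₀ {Kmax : ℕ} (hlip : Lip G ψ) (hq : QStepsN G ψ P.N) (hstep : Steps G φ)
    (hwide : ∀ i, (lo - (j : Site 2)) i + 2 * tanOff P.ℓs P.M ≤ (hi + (j : Site 2)) i)
    (hK : ∀ (i : Fin 2) (σ : ℤˣ) (z : Site 2), (SF i σ).θ (1 + P.d) ≤ (SF i σ).lin z → ∀ m : ℤ, -(P.W : ℤ) ≤ m → m ≤ P.W →
      (SF i σ).apronK z (shellD P) P.ℓ m ≤ Kmax)
    (hr₀ : P.N * (tanOff P.ℓs P.M + 2) + P.N * P.d + (P.W + Kmax + P.R') + 2 ≤ P.r₀) (hR : P.r₀ ≤ R)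
    {x : V} (hx : x ∈ outerBoundary (winGraph G w₀ R) (winLevel G ψ w₀ R lo hi j))
    (hnear : IsNear G ψ (lo - (j : Site 2)) (hi + (j : Site 2)) P w₀ R x) : ∀ v ∈ ctReg G SF P w₀ R x, v ∈ graphBall G w₀ (R - 2) := by
  intro v hv
  have hx' : x ∈ outerBoundary (winGraph G w₀ R) (Win G ψ w₀ (Finset.Icc (lo - (j : Site 2)) (hi + (j : Site 2))) R) := hx
  have hvy : v ∈ graphBall G (ctY G ψ w₀ R (lo - (j : Site 2)) (hi + (j : Site 2)) x) (P.N * (tanOff P.ℓs P.M + 2) + P.N * P.d + (P.W + Kmax + P.R')) := by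
    unfold ctReg at hv
    rcases Finset.mem_union.1 hv with h | h
    · exact graphBall_mono G _ (by omega) (ctWire_subset_graphBall' hq hwide hx' v h)
    · refine graphBall_mono G _ ?_ (ctApron_subset_graphBall SF hlip hq hstep hwide hK hx' v h)
      have : P.N * (tanOff P.ℓs P.M + 1) ≤ P.N * (tanOff P.ℓs P.M + 2) := Nat.mul_le_mul_left _ (by omega)
      omega
  have h := BoxProdZ2.mem_graphBall_add G hnear hvy
  exact graphBall_mono G _ (by omega) h

/-- **The wired region of a near contact misses the habitat pinning set.** [this work] -/
theorem not_mem_pinSetAHab_of_mem_ctReg {Kmax : ℕ} (hlip : Lip G ψ) (hq : QStepsN G ψ P.N) (hstep : Steps G φ)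
    (hwide : ∀ i, (lo - (j : Site 2)) i + 2 * tanOff P.ℓs P.M ≤ (hi + (j : Site 2)) i) (hdD : P.d + 2 ≤ shellD P)
    (hbelow : ∀ (i : Fin 2) (σ : ℤˣ) (z : Site 2), (SF i σ).lin z < (SF i σ).θ (2 + P.d) → ∀ m : ℤ, -(P.W : ℤ) ≤ m → m ≤ P.W →
      (SF i σ).lin (apronPt z (SF i σ).a (SF i σ).s m 0) + P.ℓ * (SF i σ).UL < (SF i σ).θ (shellD P))
    (habove : ∀ (i : Fin 2) (σ : ℤˣ) (z : Site 2), (SF i σ).θ (1 + P.d) ≤ (SF i σ).lin z → ∀ m : ℤ, -(P.W : ℤ) ≤ m → m ≤ P.W →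
      (SF i σ).θ 1 ≤ (SF i σ).lin (apronPt z (SF i σ).a (SF i σ).s m 0) - P.ℓ * (SF i σ).UL)
    (hK : ∀ (i : Fin 2) (σ : ℤˣ) (z : Site 2), (SF i σ).θ (1 + P.d) ≤ (SF i σ).lin z → ∀ m : ℤ, -(P.W : ℤ) ≤ m → m ≤ P.W →
      (SF i σ).apronK z (shellD P) P.ℓ m ≤ Kmax)
    (hr₀ : P.N * (tanOff P.ℓs P.M + 2) + P.N * P.d + (P.W + Kmax + P.R') + 2 ≤ P.r₀) (hR : P.r₀ ≤ R)
    {x₀ : V} (hx₀ : x₀ ∈ outerBoundary (winGraph G w₀ R) (winLevel G ψ w₀ R lo hi j))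
    (hnear : IsNear G ψ (lo - (j : Site 2)) (hi + (j : Site 2)) P w₀ R x₀) {v : V} (hv : v ∈ ctReg G SF P w₀ R x₀) :
    v ∉ pinSetAHab G SF P Ω w₀ R lo hi j := by
  have hw2 : ∀ i, (lo - (j : Site 2)) i + 2 ≤ (hi + (j : Site 2)) i := fun i => by have := hwide i; unfold tanOff at this; omega
  intro hvS
  unfold pinSetAHab at hvS
  rcases Finset.mem_union.1 hvS with h | h
  · exact not_mem_pinSetA_of_mem_ctReg SF hlip hq hstep hw2 hdD hbelow habove hx₀ hx₀ hnear hv h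
  · unfold farSetAHab at h
    obtain ⟨x, hx, hxv⟩ := Finset.mem_image.1 h
    obtain ⟨hxK, hxn⟩ := Finset.mem_filter.1 hx
    have hR2 : R - 2 + 1 ≤ R := by omega
    have := inNbrIn_not_mem_graphBall hxK hxn hR2
    rw [hxv] at this
    exact this (ctReg_subset_graphBall_w₀ SF hlip hq hstep hwide hK hr₀ hR hx₀ hnear v hv)

/-- **No seed pair of a plain contact's apron kit is a pair of a set missed by the contact and by every near wired region.** [this work] -/
theorem seed_notMem_wireSet_of (Rg : V → Finset V) {S' : Finset V} {x : V} (hx : x ∈ outerBoundary (winGraph G w₀ R) (winLevel G ψ w₀ R lo hi j))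
    (hxS : x ∉ S')
    (hreg : ∀ x₀ ∈ outerBoundary (winGraph G w₀ R) (winLevel G ψ w₀ R lo hi j), IsNear G ψ (lo - (j : Site 2)) (hi + (j : Site 2)) P w₀ R x₀ →
      ∀ v ∈ ctReg G SF P w₀ R x₀, v ∉ S')
    {e : Sym2 V} (he : e ∈ kitSeed G (apronGeomA G SF Rg P w₀ R (outerBoundary (winGraph G w₀ R) (winLevel G ψ w₀ R lo hi j))) x) :
    e ∉ wireSet (↑S' : Set V) := by
  set K := outerBoundary (winGraph G w₀ R) (winLevel G ψ w₀ R lo hi j) with hK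
  intro hw
  rcases mem_kitSeed_cases _ he with rfl | hE | ⟨v, hv, u, hu, hvu, rfl⟩
  · exact hxS (Finset.mem_coe.1 (hw.1 x (Sym2.mem_mk_left _ _)))
  · rw [mem_edgesIn_iff] at hE
    induction e using Sym2.ind with
    | h a b =>
      have ha := hE.2 a (Sym2.mem_mk_left a b); have hb := hE.2 b (Sym2.mem_mk_right a b)
      have haT := Finset.mem_coe.1 (hw.1 a (Sym2.mem_mk_left a b))
      have hab : G.Adj a b := (SimpleGraph.mem_edgeSet (G := G)).1 hE.1
      simp only [apronGeomA] at ha hb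
      split_ifs at ha hb with hnear habs
      · exact hreg x hx hnear a ha haT
      · obtain ⟨h0K, h0near, -⟩ := mem_hosts.1 (host_mem habs)
        exact hreg _ h0K h0near a ha haT
      · rw [Finset.mem_singleton] at ha hb
        exact hab.ne (ha.trans hb.symm)
  · have hvT : v ∈ S' := Finset.mem_coe.1 (hw.1 v (Sym2.mem_mk_left _ _))
    simp only [apronGeomA] at hv hu
    split_ifs at hv hu with hnear habs
    · exact hreg x hx hnear v hv hvT
    · obtain ⟨h0K, h0near, -⟩ := mem_hosts.1 (host_mem habs)
      exact hreg _ h0K h0near v hv hvT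
    · rw [Finset.mem_singleton] at hv hu
      exact hvu.ne (hv.trans hu.symm)

end Facts

/-! ## §2 The kit clause over the habitat -/

/-- **THE KIT CLAUSE OF THE APRON KIT OVER A HABITAT WINDOW** (`Γ = winGraphIn G Ω`, levels `winLevelIn ψ Ω lo hi j`, `Ω ⊇ winLevel`): per
`Ω`-contact — PADDED (not a plain contact of `(w₀, R)`): its inner `Ω`-neighbour in the target; plain FAR: its inner neighbour in the target; plain
NEAR: a face vertex in the target or the Step-IV estimate of its face w.r.t. `pinSetAHab`. [cite: KozmaNitzan2024, §4 Lemma 10, Steps III–IV] -/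
theorem kitClauseAHab [Countable V] {lo hi : Site 2} {j : ℕ} {w₀ : V} {R : ℕ}
    (SF : ∀ (i : Fin 2) (σ : ℤˣ), SideForm ψ φ (lo - (j : Site 2)) (hi + (j : Site 2)) i σ) (Rg : V → Finset V) {P : ApronPrm}
    {Kmax KCmax Rs rs cS cU Δ : ℕ}
    (hlip : Lip G ψ) (hq : QStepsN G ψ P.N) (hstep : Steps G φ) (hΔ : ∀ v, G.degree v ≤ Δ) {q : unitInterval} {δ : ℝ} (hδ : 0 < δ)
    (hwide : ∀ i, (lo - (j : Site 2)) i + 2 * tanOff P.ℓs P.M ≤ (hi + (j : Site 2)) i)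
    (hdw : ∀ i, (lo - (j : Site 2)) i + (P.d + 2 : ℕ) ≤ (hi + (j : Site 2)) i) (hdD : P.d + 2 ≤ shellD P)
    (hbelow : ∀ (i : Fin 2) (σ : ℤˣ) (z : Site 2), (SF i σ).lin z < (SF i σ).θ (2 + P.d) → ∀ m : ℤ, -(P.W : ℤ) ≤ m → m ≤ P.W →
      (SF i σ).lin (apronPt z (SF i σ).a (SF i σ).s m 0) + P.ℓ * (SF i σ).UL < (SF i σ).θ (shellD P))
    (habove : ∀ (i : Fin 2) (σ : ℤˣ) (z : Site 2), (SF i σ).θ (1 + P.d) ≤ (SF i σ).lin z → ∀ m : ℤ, -(P.W : ℤ) ≤ m → m ≤ P.W →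
      (SF i σ).θ 1 ≤ (SF i σ).lin (apronPt z (SF i σ).a (SF i σ).s m 0) - P.ℓ * (SF i σ).UL)
    (hK : ∀ (i : Fin 2) (σ : ℤˣ) (z : Site 2), (SF i σ).θ (1 + P.d) ≤ (SF i σ).lin z → ∀ m : ℤ, -(P.W : ℤ) ≤ m → m ≤ P.W →
      (SF i σ).apronK z (shellD P) P.ℓ m ≤ Kmax)
    (hKC : ∀ (i : Fin 2) (σ : ℤˣ) (z : Site 2), (SF i σ).θ (1 + P.d) ≤ (SF i σ).lin z → (SF i σ).lin z < (SF i σ).θ (2 + P.d) →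
      (SF i σ).kitK z (shellD P) P.A ≤ KCmax)
    (hcomp : ∀ (v w : V) (n : ℕ), φ v - φ w ∈ box 2 n → ∀ i, |ψ v i - ψ w i| ≤ n + 1)
    (hT : (P.W : ℤ) + Kmax + P.ℓ + 1 ≤ tanOff P.ℓs P.M)
    (hRg : ∀ c, ∀ u ∈ Rg c, u ∈ graphBall G c Rs) (hRgcard : ∀ c, (Rg c).card ≤ cU) (hcU1 : 1 ≤ cU)
    (hr₀ : P.N * (tanOff P.ℓs P.M + 2) + P.N * P.d + (P.W + Kmax + P.R') + 2 ≤ P.r₀) (hR : P.r₀ ≤ R)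
    (hrs : 2 * (1 + P.N * (tanOff P.ℓs P.M + 2) + P.N * P.d + (P.W + Kmax + P.R') + (KCmax + Rs)) ≤ rs)
    (hcS : (P.N + 1) * (tanOff P.ℓs P.M + 1) + (P.N + 1) * P.d + (2 * P.W + 1) * (Kmax + 1) * (Δ + 1) ^ P.R' ≤ cS)
    -- the habitat, the level's source/support, the weighting, the region and the target
    {Ω : Finset V} (hfull : winLevel G ψ w₀ R lo hi j ⊆ Ω) (k : ℕ) (o : V) (Sfin : Finset V) {Wt : Sym2 V → unitInterval} {D T : Finset V}
    (hXD : winLevelIn ψ Ω lo hi j ⊆ D) {N : ℕ} (hN : k * (Δ + 1) ^ (2 * rs) ≤ N) (hk : (1 - (q : ℝ) ^ (1 + Δ * cS + cS * cU)) ^ k ≤ δ)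
    -- per contact
    (hpad : ∀ x ∈ outerBoundary (winGraphIn G Ω) (winLevelIn ψ Ω lo hi j), x ∉ outerBoundary (winGraph G w₀ R) (winLevel G ψ w₀ R lo hi j) →
      inNbrIn G ψ Ω (Finset.Icc (lo - (j : Site 2)) (hi + (j : Site 2))) x ∈ T)
    (hfar : ∀ x ∈ outerBoundary (winGraph G w₀ R) (winLevel G ψ w₀ R lo hi j), ¬ IsNear G ψ (lo - (j : Site 2)) (hi + (j : Site 2)) P w₀ R x →
      ctY G ψ w₀ R (lo - (j : Site 2)) (hi + (j : Site 2)) x ∈ T)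
    (hnear : ∀ x ∈ outerBoundary (winGraph G w₀ R) (winLevel G ψ w₀ R lo hi j), IsNear G ψ (lo - (j : Site 2)) (hi + (j : Site 2)) P w₀ R x →
      (∃ u ∈ ctFace G SF Rg P w₀ R x, u ∈ T) ∨
      1 - 3 * δ ≤ (prodBernoulli Wt).real {ω | ∃ u ∈ ctFace G SF Rg P w₀ R x,
        1 - δ < (prodBernoulli (pinW Wt (wireSet (↑(pinSetAHab G SF P Ω w₀ R lo hi j) : Set V)) ω)).real
          (⋃ t ∈ T, openConnIn (↑D : Set V) u t)}) :
    ∃ (σ : SData V) (S : Finset V), SHyp (winLDataIn G ψ Ω lo hi o Sfin) j σ ∧ σ.N ≤ N ∧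
      (1 - (q : ℝ) ^ σ.sB) ^ σ.k ≤ δ ∧ S ⊆ (winLDataIn G ψ Ω lo hi o Sfin).X j ∧ S ⊆ D ∧
      (∀ x ∈ σ.K, ∀ e ∈ σ.seed x, e ∉ wireSet (↑S : Set V)) ∧ (∀ x ∈ σ.K, σ.face x ⊆ S) ∧
      (∀ x ∈ σ.K, 1 - 3 * δ ≤ (prodBernoulli Wt).real {ω | ∃ u ∈ σ.face x,
        1 - δ < (prodBernoulli (pinW Wt (wireSet (↑S : Set V)) ω)).real (⋃ t ∈ T, openConnIn (↑D : Set V) u t)}) := by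
  set K := outerBoundary (winGraph G w₀ R) (winLevel G ψ w₀ R lo hi j) with hKdef
  set κ := apronGeomA G SF Rg P w₀ R K with hκ
  set Spin := pinSetAHab G SF P Ω w₀ R lo hi j with hSpin
  have hKeq : winLevel G ψ w₀ R lo hi j = Win G ψ w₀ (Finset.Icc (lo - (j : Site 2)) (hi + (j : Site 2))) R := rfl
  have hw2 : ∀ i, (lo - (j : Site 2)) i + 2 ≤ (hi + (j : Site 2)) i := fun i => by have := hwide i; unfold tanOff at this; omega
  have hr₀' : P.N * (tanOff P.ℓs P.M + 2) + P.N * P.d + (P.W + Kmax + P.R') ≤ P.r₀ := by omega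
  have hOK : KitOK G ψ w₀ R lo hi j rs cS cU κ :=
    kitOK_apronA SF Rg hlip hq hstep hΔ hwide hdw hbelow habove hK hKC hcomp hT hRg hRgcard hcU1 hr₀' hR hrs hcS
  have hrs1 : 1 ≤ rs := by omega
  have hcS1 : 1 ≤ cS := by
    have : 1 ≤ (2 * P.W + 1) * (Kmax + 1) * (Δ + 1) ^ P.R' := Nat.one_le_iff_ne_zero.2 (by positivity); omega
  have hOKh : KitOKHab G ψ Ω lo hi j rs cS cU (habPad G ψ Ω w₀ R lo hi j κ) := kitOKHab_pad hOK hfull hrs1 hcS1 hcU1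
  have hSX : Spin ⊆ winLevelIn ψ Ω lo hi j := pinSetAHab_subset_winLevelIn SF hfull
  have hSD : Spin ⊆ D := hSX.trans hXD
  -- faces lie in the pinning set
  have hface : ∀ x ∈ outerBoundary (winGraphIn G Ω) (winLevelIn ψ Ω lo hi j), (habPad G ψ Ω w₀ R lo hi j κ).U x ⊆ Spin := by
    intro x hx u hu
    rw [hSpin]; unfold pinSetAHab; rw [Finset.mem_union]
    by_cases hp : x ∈ K
    · rw [(habPad_of_mem hp).2.2] at hu
      exact Or.inl (face_subset_pinSetA SF Rg P hp hu)
    · rw [(habPad_of_not_mem hp).2.2, Finset.mem_singleton] at hu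
      refine Or.inr ?_
      rw [hu]; unfold farSetAHab
      exact Finset.mem_image.2 ⟨x, Finset.mem_filter.2 ⟨hx, hp⟩, rfl⟩
  refine ⟨kitSDataHab G ψ hΔ Ω lo hi j (habPad G ψ Ω w₀ R lo hi j κ) rs cS cU k, Spin, shyp_kitHab hlip hOKh o Sfin k, hN, hk,
    by rw [winLDataIn_X]; exact hSX, hSD, fun x hx e he => ?_, fun x hx => ?_, fun x hx => ?_⟩
  · -- seeds avoid the pairs of the pinning set
    rw [kitSDataHab_K] at hx
    rw [kitSDataHab_seed] at he
    by_cases hp : x ∈ K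
    · rw [kitSeed_congr (habPad_of_mem hp).1 (habPad_of_mem hp).2.1 (habPad_of_mem hp).2.2] at he
      refine seed_notMem_wireSet_of SF Rg hp (fun h => ?_) (fun x₀ hx₀ hn v hv =>
        not_mem_pinSetAHab_of_mem_ctReg SF hlip hq hstep hwide hdD hbelow habove hK hr₀ hR hx₀ hn hv) he
      have h1 := hSX h
      have hp' : x ∈ outerBoundary (winGraph G w₀ R) (Win G ψ w₀ (Finset.Icc (lo - (j : Site 2)) (hi + (j : Site 2))) R) := by
        rw [hKdef, hKeq] at hp; exact hp
      exact ((mem_outerBoundary_win_iff G ψ).1 hp').2.1 ((mem_winLevelIn_iff ψ).1 h1).2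
    · intro hw
      have hS1 : (habPad G ψ Ω w₀ R lo hi j κ).S x = {(habPad G ψ Ω w₀ R lo hi j κ).y x} := by
        rw [(habPad_of_not_mem hp).2.1, (habPad_of_not_mem hp).1]
      have hU1 : (habPad G ψ Ω w₀ R lo hi j κ).U x = {(habPad G ψ Ω w₀ R lo hi j κ).y x} := by
        rw [(habPad_of_not_mem hp).2.2, (habPad_of_not_mem hp).1]
      have hxS : x ∈ Spin := Finset.mem_coe.1 (hw.1 x (mem_kitSeed_pad hS1 hU1 he))
      have hx' : x ∈ outerBoundary (winGraphIn G Ω) (WinIn ψ Ω (Finset.Icc (lo - (j : Site 2)) (hi + (j : Site 2)))) := hx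
      exact ((mem_outerBoundary_winIn_iff G ψ).1 hx').2.1 ((mem_winLevelIn_iff ψ).1 (hSX hxS)).2
  · rw [kitSDataHab_K] at hx; rw [kitSDataHab_face]; exact hface x hx
  · -- Step IV: the four kinds of contact
    rw [kitSDataHab_K] at hx
    rw [kitSDataHab_face]
    by_cases hp : x ∈ K
    · have hUeq : (habPad G ψ Ω w₀ R lo hi j κ).U x = κ.U x := (habPad_of_mem hp).2.2
      rw [hUeq]
      by_cases hnx : IsNear G ψ (lo - (j : Site 2)) (hi + (j : Site 2)) P w₀ R x
      · have hUx : κ.U x = ctFace G SF Rg P w₀ R x := by simp only [hκ, apronGeomA, if_pos hnx]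
        rw [hUx]
        rcases hnear x hp hnx with ⟨u, hu, huT⟩ | hIV
        · exact hIV_of_mem_face hδ hu huT (hSD (hface x hx (by rw [hUeq, hUx]; exact hu)))
        · exact hIV
      · by_cases habs : (hosts G SF P w₀ R K x).Nonempty
        · obtain ⟨h0K, h0near, -⟩ := mem_hosts.1 (host_mem habs)
          have hUx : κ.U x = ctFace G SF Rg P w₀ R (host G SF P w₀ R K x) := by simp only [hκ, apronGeomA, if_neg hnx, if_pos habs]
          have hU0 : κ.U (host G SF P w₀ R K x) = ctFace G SF Rg P w₀ R (host G SF P w₀ R K x) := by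
            simp only [hκ, apronGeomA, if_pos h0near]
          rw [hUx]
          rcases hnear _ h0K h0near with ⟨u, hu, huT⟩ | hIV
          · refine hIV_of_mem_face hδ hu huT (hSD ?_)
            rw [hSpin]; unfold pinSetAHab
            exact Finset.mem_union_left _ (face_subset_pinSetA SF Rg P h0K (by rw [hU0]; exact hu))
          · exact hIV
        · have hUx : κ.U x = {ctY G ψ w₀ R (lo - (j : Site 2)) (hi + (j : Site 2)) x} := by
            simp only [hκ, apronGeomA, if_neg hnx, if_neg habs]
          rw [hUx]
          exact hIV_of_mem_face hδ (Finset.mem_singleton_self _) (hfar x hp hnx)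
            (hSD (hface x hx (by rw [hUeq, hUx]; exact Finset.mem_singleton_self _)))
    · have hUx : (habPad G ψ Ω w₀ R lo hi j κ).U x = {inNbrIn G ψ Ω (Finset.Icc (lo - (j : Site 2)) (hi + (j : Site 2))) x} :=
        (habPad_of_not_mem hp).2.2
      rw [hUx]
      exact hIV_of_mem_face hδ (Finset.mem_singleton_self _) (hpad x hx hp) (hSD (hface x hx (by rw [hUx]; exact Finset.mem_singleton_self _)))

end Skelφ

end Summit.CriticalPhenomena.PercolationContinuityZ3.Theorems.Transplant

end
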